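import Mathlib
import HarnessLib
import Summits.Ventures.LatticeQCDFlow.Exactness.U1MaskedLayerEquiv
import Summits.Ventures.LatticeQCDFlow.Exactness.U1MultiStepFTHMCErgodic

/-!
# The engine's LEARNED `U(1)` masked layer is pinched: FT-HMC through it — single-step and multi-step — is uniformly ergodic

HONEST FRAMING: exact (Metropolis-corrected) sampling algorithms for lattice gauge theory;
figures of merit are autocorrelation/cost numbers at stated couplings and volumes; no
continuum-physics claim.

Venture `LatticeQCDFlow` (cell pub-lqcd), topic `Exactness`, FANOUT row 14 (`eng-flowhmc`, engine
`latflow.fthmc`, family B, `U(1)` rung: the LEARNED masked layer `θ ↦ θ + Σ_k c_k sin(α_k − θ)` on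
the active links, coefficients / angles any measurable functions of the frozen links — GEN-5's
`U1MaskedLayerCoupling` / `U1MaskedLayerEquiv` certified it and typed FT-HMC through it as EXACT;
GEN-9's `U1FTHMCErgodic` listed "the learned `U(1)` members" as NOT CLAIMED for ergodicity).  NEW
WORK of the cell over GEN-5's `U1MaskedLayerEquiv.lean` (the layer as `coupleEquiv ψ …` with
Jacobian `coupleJac p jac = ∏_active (1 − C)`), `U1MaskedLayerCircleMap.u1LayerJac_mem_Icc`
(`1 − κ ≤ 1 − C(θ) ≤ 1 + κ`), `CircleGroupJacobian.hasJacobian_coupleFun_circleGroup_u1Layer`,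
GEN-9's `u1LeapfrogFTHMC_uniformlyErgodic` (single step) and ROW 9's
`U1MultiStepFTHMCErgodic.u1LeapfrogFTHMCN_uniformlyErgodic` (multi-step kernel `u1LeapfrogHMCN`,
`4Kεn² ≤ 3`, landed today); nothing is cited as a fact; no number.

* §1 `coupleJac_mem_Icc` — ANY coupling layer whose single-coordinate Jacobians lie in
  `[j₁, j₂]`, `0 ≤ j₁`, has `coupleJac ∈ [j₁^#active, j₂^#active]` (any group);
  **`u1CoupleJac_mem_Icc`** — the learned `U(1)` layer under the UNIFORM CLAMP `Σ_k |c_k(a, y)| ≤ κ₀`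
  (the engine's `(κ/n)·tanh` squashing enforces exactly such a clamp) is PINCHED:
  `(1 − κ₀)^#active ≤ coupleJac ≤ (1 + κ₀)^#active`;
* §2 **`u1MaskedLayer_fthmc_uniformlyErgodic`** — single-step FT-HMC (row 9's kernel for
  `S∘F − log J` reported through the layer `F`), any measurable `|S| ≤ s`, `‖g‖ ≤ b`, `ε, κ > 0`,
  `κ₀ < 1`: converges to `π_S` geometrically from EVERY start; **`u1MaskedLayer_fthmc_invariant_unique`**;
* §3 **`u1MaskedLayer_fthmcN_uniformlyErgodic`** / **`_invariant_unique`** — the same at EVERY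
  `nstep` under the short-trajectory condition `4Kεn² ≤ 3` on the (`K`-Lipschitz, bounded) increment.

NOT CLAIMED: members with several learned layers (compose: `HasJacobian.comp` + the product of the
pinches, as `U1WilsonFlowLOMemberErgodic` does for the LO member — not restated); the Lipschitz
constant of the engine's force through the layer; `SU(2)` learned layers (GEN-9's
`SU2MaskedKickErgodic` is the single-step twin); any usable `δ`; floating point; any number.
-/

noncomputable section

namespace Summit.Ventures.LatticeQCDFlow.Exactness

open Real Set Function MeasureTheory Summit.Ventures.LatticeQCDFlow.Theory2
open ProbabilityTheory ProbabilityTheory.Kernel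
open Literature.MathematicalPhysics.QuantumFieldTheory (haarProbability)
open scoped NNReal ENNReal

/-! ## §1 Pinched single-coordinate Jacobians give a pinched layer Jacobian -/

section Pinch

variable {ι : Type*} [Fintype ι] {p : ι → Prop} [DecidablePred p] {G : Type*}

/-- **A coupling layer with single-coordinate Jacobians in `[j₁, j₂]` (`0 ≤ j₁`) has
`coupleJac ∈ [j₁^#active, j₂^#active]`.** -/
theorem coupleJac_mem_Icc {j : {i // p i} → ({i // ¬p i} → G) → G → ℝ} {j₁ j₂ : ℝ} (hj₁ : 0 ≤ j₁)
    (hj : ∀ a y g, j a y g ∈ Icc j₁ j₂) (U : ι → G) :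
    coupleJac p j U ∈ Icc (j₁ ^ Fintype.card {i // p i}) (j₂ ^ Fintype.card {i // p i}) := by
  unfold coupleJac
  constructor
  · calc j₁ ^ Fintype.card {i // p i} = ∏ _a : {i // p i}, j₁ := by
          rw [Finset.prod_const, Finset.card_univ]
      _ ≤ _ := Finset.prod_le_prod (fun a _ => hj₁) fun a _ => (hj a _ _).1
  · calc (∏ a : {i // p i}, j a (fun f => U f) (U a)) ≤ ∏ _a : {i // p i}, j₂ :=
          Finset.prod_le_prod (fun a _ => hj₁.trans (hj a _ _).1) fun a _ => (hj a _ _).2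
      _ = j₂ ^ Fintype.card {i // p i} := by rw [Finset.prod_const, Finset.card_univ]

variable {n : ℕ}

/-- **The learned `U(1)` masked layer is pinched under a uniform clamp**: if
`Σ_k |c_k(a, y)| ≤ κ₀` for every active link `a` and frozen configuration `y`, then
`(1 − κ₀)^#active ≤ ∏_active (1 − C) ≤ (1 + κ₀)^#active` (for `κ₀ ≤ 1`). -/
theorem u1CoupleJac_mem_Icc (c α : {i // p i} → ({i // ¬p i} → Circle) → Fin n → ℝ) {κ₀ : ℝ}
    (hκ₀ : κ₀ ≤ 1) (hκ : ∀ a y, ∑ k, |c a y k| ≤ κ₀)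
    {jac : {i // p i} → ({i // ¬p i} → Circle) → Circle → ℝ}
    (hjac : ∀ a y (θ : ℝ), jac a y (Circle.exp θ) = 1 - ∑ k, c a y k * cos (α a y k - θ))
    (U : ι → Circle) :
    coupleJac p jac U ∈ Icc ((1 - κ₀) ^ Fintype.card {i // p i}) ((1 + κ₀) ^ Fintype.card {i // p i}) := by
  refine coupleJac_mem_Icc (by linarith) (fun a y g => ?_) U
  obtain ⟨θ, rfl⟩ := Circle.exp_surjective g
  rw [hjac]
  have h := u1LayerJac_mem_Icc (c a y) (α a y) θ
  exact ⟨le_trans (by linarith [hκ a y]) h.1, h.2.trans (by linarith [hκ a y])⟩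

end Pinch

/-! ## §2 Single-step FT-HMC through the learned layer is uniformly ergodic -/

section Single

variable {ι : Type*} [Fintype ι] {p : ι → Prop} [DecidablePred p] {n : ℕ}
  {ε κ : ℝ} {g : (ι → Circle) → ι → ℝ} {S : (ι → Circle) → ℝ} {s : ℝ}

omit [Fintype ι] [DecidablePred p] in
/-- The per-link factor is jointly measurable in (link, frozen links). -/
theorem measurable_u1CoupleJacFactor (c α : {i // p i} → ({i // ¬p i} → Circle) → Fin n → ℝ)
    (hc : ∀ a k, Measurable fun y => c a y k) (hα : ∀ a k, Measurable fun y => α a y k)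
    {jac : {i // p i} → ({i // ¬p i} → Circle) → Circle → ℝ}
    (hjac : ∀ a y (θ : ℝ), jac a y (Circle.exp θ) = 1 - ∑ k, c a y k * cos (α a y k - θ))
    (a : {i // p i}) : Measurable fun q : Circle × ({i // ¬p i} → Circle) => jac a q.2 q.1 := by
  refine Circle.measurable_of_measurable_comp_exp_prod ?_
  simp_rw [hjac]
  exact measurable_const.sub (Finset.measurable_sum _ fun k _ =>
    ((hc a k).comp measurable_snd).mul
      (measurable_cos.comp (((hα a k).comp measurable_snd).sub measurable_fst)))

/-- **SINGLE-STEP FT-HMC THROUGH THE ENGINE'S LEARNED `U(1)` MASKED LAYER IS UNIFORMLY ERGODIC.**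
Layer `F = coupleEquiv ψ …` with the engine's single-link maps (coefficients / angles measurable in
the frozen links, uniform clamp `Σ_k |c_k| ≤ κ₀ < 1`), Jacobian `J = coupleJac p jac`; row 9's
single-step kernel for `S∘F − log J` reported through `F`; any measurable `|S| ≤ s`, `‖g‖ ≤ b`,
`ε, κ > 0`: `|μ₀K̃ᵗ(A) − π_S(A)| ≤ (1 − δ)ᵗ` for some `δ ∈ (0, 1]`, EVERY initial law. -/
theorem u1MaskedLayer_fthmc_uniformlyErgodic
    (c α : {i // p i} → ({i // ¬p i} → Circle) → Fin n → ℝ)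
    (hc : ∀ a k, Measurable fun y => c a y k) (hα : ∀ a k, Measurable fun y => α a y k)
    {κ₀ : ℝ} (hκ₀ : κ₀ < 1) (hκ : ∀ a y, ∑ k, |c a y k| ≤ κ₀)
    (ψ : {i // p i} → ({i // ¬p i} → Circle) → Circle ≃ᵐ Circle)
    (hψ : ∀ a y (θ : ℝ), ψ a y (Circle.exp θ) = Circle.exp (θ + ∑ k, c a y k * sin (α a y k - θ)))
    (hψm : ∀ a, Measurable fun q : Circle × ({i // ¬p i} → Circle) => ψ a q.2 q.1)
    (hψsm : ∀ a, Measurable fun q : Circle × ({i // ¬p i} → Circle) => (ψ a q.2).symm q.1)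
    {jac : {i // p i} → ({i // ¬p i} → Circle) → Circle → ℝ}
    (hjac : ∀ a y (θ : ℝ), jac a y (Circle.exp θ) = 1 - ∑ k, c a y k * cos (α a y k - θ))
    (hε : 0 < ε) (hκ' : 0 < κ) (hg : Measurable g) {b : ℝ} (hb0 : 0 ≤ b) (hb : ∀ u l, ‖g u l‖ ≤ b)
    (hS : Measurable S) (hs : ∀ u, |S u| ≤ s) :
    ∃ δ : ℝ, 0 < δ ∧ δ ≤ 1 ∧ ∀ (μ₀ : Measure (ι → Circle)) [IsProbabilityMeasure μ₀] (t : ℕ)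
      (A : Set (ι → Circle)),
      |((fun m : Measure (ι → Circle) =>
            m.bind (conjKernel (u1LeapfrogHMC ε κ hg fun v =>
              S (coupleEquiv ψ hψm hψsm v) - Real.log (coupleJac p jac v)) (coupleEquiv ψ hψm hψsm)))^[t]
          μ₀).real A - (u1GibbsLaw S).real A| ≤ (1 - δ) ^ t := by
  have hκlt : ∀ a y, ∑ k, |c a y k| < 1 := fun a y => (hκ a y).trans_lt hκ₀
  have hF : HasJacobian (Measure.pi fun _ : ι => haarProbability Circle)
      (coupleEquiv ψ hψm hψsm) fun U => ENNReal.ofReal (coupleJac p jac U) :=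
    hasJacobian_coupleFun_circleGroup_u1Layer c α hc hα hκlt (ψ := fun a y g => ψ a y g) hψ hjac
  have hpinch := fun U => u1CoupleJac_mem_Icc c α hκ₀.le hκ hjac U
  exact u1LeapfrogFTHMC_uniformlyErgodic hε hκ' hg hb0 hb hS hs
    (pow_pos (by linarith) _) (fun v => (hpinch v).1) (fun v => (hpinch v).2)
    (measurable_coupleJac (measurable_u1CoupleJacFactor c α hc hα hjac)) hF

/-- **`π_S` is the unique invariant probability law** of single-step FT-HMC through the learned
`U(1)` layer (same hypotheses). -/
theorem u1MaskedLayer_fthmc_invariant_unique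
    (c α : {i // p i} → ({i // ¬p i} → Circle) → Fin n → ℝ)
    (hc : ∀ a k, Measurable fun y => c a y k) (hα : ∀ a k, Measurable fun y => α a y k)
    {κ₀ : ℝ} (hκ₀ : κ₀ < 1) (hκ : ∀ a y, ∑ k, |c a y k| ≤ κ₀)
    (ψ : {i // p i} → ({i // ¬p i} → Circle) → Circle ≃ᵐ Circle)
    (hψ : ∀ a y (θ : ℝ), ψ a y (Circle.exp θ) = Circle.exp (θ + ∑ k, c a y k * sin (α a y k - θ)))
    (hψm : ∀ a, Measurable fun q : Circle × ({i // ¬p i} → Circle) => ψ a q.2 q.1)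
    (hψsm : ∀ a, Measurable fun q : Circle × ({i // ¬p i} → Circle) => (ψ a q.2).symm q.1)
    {jac : {i // p i} → ({i // ¬p i} → Circle) → Circle → ℝ}
    (hjac : ∀ a y (θ : ℝ), jac a y (Circle.exp θ) = 1 - ∑ k, c a y k * cos (α a y k - θ))
    (hε : 0 < ε) (hκ' : 0 < κ) (hg : Measurable g) {b : ℝ} (hb0 : 0 ≤ b) (hb : ∀ u l, ‖g u l‖ ≤ b)
    (hS : Measurable S) (hs : ∀ u, |S u| ≤ s) {π' : Measure (ι → Circle)} [IsProbabilityMeasure π']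
    (hπ' : Invariant (conjKernel (u1LeapfrogHMC ε κ hg fun v =>
      S (coupleEquiv ψ hψm hψsm v) - Real.log (coupleJac p jac v)) (coupleEquiv ψ hψm hψsm)) π') :
    π' = u1GibbsLaw S := by
  have hκlt : ∀ a y, ∑ k, |c a y k| < 1 := fun a y => (hκ a y).trans_lt hκ₀
  have hF : HasJacobian (Measure.pi fun _ : ι => haarProbability Circle)
      (coupleEquiv ψ hψm hψsm) fun U => ENNReal.ofReal (coupleJac p jac U) :=
    hasJacobian_coupleFun_circleGroup_u1Layer c α hc hα hκlt (ψ := fun a y g => ψ a y g) hψ hjac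
  have hpinch := fun U => u1CoupleJac_mem_Icc c α hκ₀.le hκ hjac U
  exact u1LeapfrogFTHMC_invariant_unique hε hκ' hg hb0 hb hS hs
    (pow_pos (by linarith) _) (fun v => (hpinch v).1) (fun v => (hpinch v).2)
    (measurable_coupleJac (measurable_u1CoupleJacFactor c α hc hα hjac)) hF hπ'

end Single

/-! ## §3 Multi-step FT-HMC through the learned layer is uniformly ergodic for short trajectories -/

section Multi

variable {ι : Type*} [Fintype ι] {p : ι → Prop} [DecidablePred p] {n : ℕ}
  {ε κ : ℝ} {g : (ι → Circle) → ι → ℝ} {S : (ι → Circle) → ℝ} {s : ℝ}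

/-- **MULTI-STEP FT-HMC THROUGH THE ENGINE'S LEARNED `U(1)` MASKED LAYER IS UNIFORMLY ERGODIC FOR
SHORT TRAJECTORIES.**  Same layer hypotheses; row 9's `N`-step kernel `u1LeapfrogHMCN` for
`S∘F − log J` reported through `F`; increment `‖g u l‖ ≤ b`, `K`-Lipschitz, `4KεN² ≤ 3`;
`ε, κ > 0`, `N ≥ 1`, measurable `|S| ≤ s`. -/
theorem u1MaskedLayer_fthmcN_uniformlyErgodic
    (c α : {i // p i} → ({i // ¬p i} → Circle) → Fin n → ℝ)
    (hc : ∀ a k, Measurable fun y => c a y k) (hα : ∀ a k, Measurable fun y => α a y k)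
    {κ₀ : ℝ} (hκ₀ : κ₀ < 1) (hκ : ∀ a y, ∑ k, |c a y k| ≤ κ₀)
    (ψ : {i // p i} → ({i // ¬p i} → Circle) → Circle ≃ᵐ Circle)
    (hψ : ∀ a y (θ : ℝ), ψ a y (Circle.exp θ) = Circle.exp (θ + ∑ k, c a y k * sin (α a y k - θ)))
    (hψm : ∀ a, Measurable fun q : Circle × ({i // ¬p i} → Circle) => ψ a q.2 q.1)
    (hψsm : ∀ a, Measurable fun q : Circle × ({i // ¬p i} → Circle) => (ψ a q.2).symm q.1)
    {jac : {i // p i} → ({i // ¬p i} → Circle) → Circle → ℝ}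
    (hjac : ∀ a y (θ : ℝ), jac a y (Circle.exp θ) = 1 - ∑ k, c a y k * cos (α a y k - θ))
    (hε : 0 < ε) (hκ' : 0 < κ) {N : ℕ} (hN : 1 ≤ N) (hg : Measurable g) {K : ℝ≥0}
    (hgK : LipschitzWith K g) (hshort : 4 * (K : ℝ) * ε * (N : ℝ) ^ 2 ≤ 3)
    {b : ℝ} (hb0 : 0 ≤ b) (hb : ∀ u l, ‖g u l‖ ≤ b) (hS : Measurable S) (hs : ∀ u, |S u| ≤ s) :
    ∃ δ : ℝ, 0 < δ ∧ δ ≤ 1 ∧ ∀ (μ₀ : Measure (ι → Circle)) [IsProbabilityMeasure μ₀] (t : ℕ)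
      (A : Set (ι → Circle)),
      |((fun m : Measure (ι → Circle) =>
            m.bind (conjKernel (u1LeapfrogHMCN ε κ hg (fun v =>
              S (coupleEquiv ψ hψm hψsm v) - Real.log (coupleJac p jac v)) N) (coupleEquiv ψ hψm hψsm)))^[t]
          μ₀).real A - (u1GibbsLaw S).real A| ≤ (1 - δ) ^ t := by
  have hκlt : ∀ a y, ∑ k, |c a y k| < 1 := fun a y => (hκ a y).trans_lt hκ₀
  have hF : HasJacobian (Measure.pi fun _ : ι => haarProbability Circle)
      (coupleEquiv ψ hψm hψsm) fun U => ENNReal.ofReal (coupleJac p jac U) :=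
    hasJacobian_coupleFun_circleGroup_u1Layer c α hc hα hκlt (ψ := fun a y g => ψ a y g) hψ hjac
  have hpinch := fun U => u1CoupleJac_mem_Icc c α hκ₀.le hκ hjac U
  exact u1LeapfrogFTHMCN_uniformlyErgodic hε hκ' hN hg hgK hshort hb0 hb hS hs
    (pow_pos (by linarith) _) (fun v => (hpinch v).1) (fun v => (hpinch v).2)
    (measurable_coupleJac (measurable_u1CoupleJacFactor c α hc hα hjac)) hF

/-- **`π_S` is the unique invariant probability law** of multi-step FT-HMC through the learned
`U(1)` layer (same hypotheses). -/
theorem u1MaskedLayer_fthmcN_invariant_unique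
    (c α : {i // p i} → ({i // ¬p i} → Circle) → Fin n → ℝ)
    (hc : ∀ a k, Measurable fun y => c a y k) (hα : ∀ a k, Measurable fun y => α a y k)
    {κ₀ : ℝ} (hκ₀ : κ₀ < 1) (hκ : ∀ a y, ∑ k, |c a y k| ≤ κ₀)
    (ψ : {i // p i} → ({i // ¬p i} → Circle) → Circle ≃ᵐ Circle)
    (hψ : ∀ a y (θ : ℝ), ψ a y (Circle.exp θ) = Circle.exp (θ + ∑ k, c a y k * sin (α a y k - θ)))
    (hψm : ∀ a, Measurable fun q : Circle × ({i // ¬p i} → Circle) => ψ a q.2 q.1)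
    (hψsm : ∀ a, Measurable fun q : Circle × ({i // ¬p i} → Circle) => (ψ a q.2).symm q.1)
    {jac : {i // p i} → ({i // ¬p i} → Circle) → Circle → ℝ}
    (hjac : ∀ a y (θ : ℝ), jac a y (Circle.exp θ) = 1 - ∑ k, c a y k * cos (α a y k - θ))
    (hε : 0 < ε) (hκ' : 0 < κ) {N : ℕ} (hN : 1 ≤ N) (hg : Measurable g) {K : ℝ≥0}
    (hgK : LipschitzWith K g) (hshort : 4 * (K : ℝ) * ε * (N : ℝ) ^ 2 ≤ 3)
    {b : ℝ} (hb0 : 0 ≤ b) (hb : ∀ u l, ‖g u l‖ ≤ b) (hS : Measurable S) (hs : ∀ u, |S u| ≤ s)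
    {π' : Measure (ι → Circle)} [IsProbabilityMeasure π']
    (hπ' : Invariant (conjKernel (u1LeapfrogHMCN ε κ hg (fun v =>
      S (coupleEquiv ψ hψm hψsm v) - Real.log (coupleJac p jac v)) N) (coupleEquiv ψ hψm hψsm)) π') :
    π' = u1GibbsLaw S := by
  have hκlt : ∀ a y, ∑ k, |c a y k| < 1 := fun a y => (hκ a y).trans_lt hκ₀
  have hF : HasJacobian (Measure.pi fun _ : ι => haarProbability Circle)
      (coupleEquiv ψ hψm hψsm) fun U => ENNReal.ofReal (coupleJac p jac U) :=
    hasJacobian_coupleFun_circleGroup_u1Layer c α hc hα hκlt (ψ := fun a y g => ψ a y g) hψ hjac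
  have hpinch := fun U => u1CoupleJac_mem_Icc c α hκ₀.le hκ hjac U
  exact u1LeapfrogFTHMCN_invariant_unique hε hκ' hN hg hgK hshort hb0 hb hS hs
    (pow_pos (by linarith) _) (fun v => (hpinch v).1) (fun v => (hpinch v).2)
    (measurable_coupleJac (measurable_u1CoupleJacFactor c α hc hα hjac)) hF hπ'

end Multi

end Summit.Ventures.LatticeQCDFlow.Exactness
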